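import Mathlib
import Summits.Ventures.PercRepro2.LocRows
import Summits.Ventures.PercRepro2.SwRow
import Summits.Ventures.PercRepro2.SwOut
import Summits.Ventures.PercRepro2.SwAllRow
import Summits.Ventures.PercRepro2.SwOutAll
import Summits.Ventures.PercRepro2.SwOutArmFlip
import Summits.Ventures.PercRepro2.SwOutArmThm
import Summits.Ventures.PercRepro2.SwOutJunction
import Summits.Ventures.PercRepro2.SwOutJunctionRegion
import Summits.Ventures.PercRepro2.SwOutCoreDefs
import Summits.Ventures.PercRepro2.SwOutCoreKey

/-!
# The (H1) single junction: vocabulary and the two sides (blind cell PercRepro2, night-4 g13,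
2026-08-26; proofs/NIGHT4-G12.md §0–§1, proofs/NIGHT4-G13.md §4 (C1))

A single-junction base region: `u ∈ U ∖ {h, o}` has no loop, no outside edge and is not adjacent
to `h`; every other vertex of `U ∖ {h, o}` carries an outside edge or no edge.  The SIMPLE-ARM
HYPOTHESIS (H1): every neighbour of `u` is adjacent to `h` or lies in a PURE component of
`G[U ∖ {h, u}]` (one with no neighbour of `h`).  For a `Q`-configuration of the class with `u` in
the hull of `h` and the hull of `u` inside `U` (the CORE KIND), the extended hull
`H⁺ = hull h ∪ hull u` splits into its RED part `redExt = (C_R(h) ∪ C_R(u)) ∖ {h, u}` and its BLUE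
part `blueExt = (C_B(h) ∪ C_B(u)) ∖ {h, u}`: they are disjoint (`redExt_disjoint_blueExt`: a
vertex of both would carry an outside edge of a colour leading out of `U`, or be the mark `o`)
and no edge joins them (`no_edge_redExt_blueExt`).  The ARMS are the components of
`G[H⁺ ∖ {h, u}]` (`armC`), each inside one side; `armsC` is the finite set of arms (reached by an
edge from `h` or from `u`), `pureC` marks the arms with no neighbour of `h`.
-/

namespace Summit.Ventures.PercRepro2

namespace LocRows

open Hull

variable {V : Type*} {E : Type*} [Fintype E] [DecidableEq E]

open scoped Classical

variable {ends : E → Sym2 V}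

section Vocabulary

variable (ends) (U : Set V) (h u : V)

/-- The component of `p` in `G[U ∖ {h, u}]`. -/
noncomputable def compU (p : V) : Set V :=
  cluster ends (fun e => decide (e ∈ within ends (U \ {h, u}))) p

/-- **The simple-arm hypothesis (H1)**: every neighbour of `u` is adjacent to `h` or lies in a
component of `G[U ∖ {h, u}]` with no neighbour of `h`. -/
def H1 : Prop :=
  ∀ e p, ends e = s(u, p) → (∃ e', ends e' = s(p, h)) ∨ ∀ q ∈ compU ends U h u p, ∀ e', ends e' ≠ s(h, q)

variable {U}

/-- The red part of the extended hull, without `h` and `u`. -/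
def redExt (ζ : Config E) : Set V := (cluster ends ζ h ∪ cluster ends ζ u) \ {h, u}

/-- The all-open colouring of the edges inside `H⁺ ∖ {h, u}`. -/
noncomputable def armConfigC (ζ : Config E) : Config E :=
  fun e => decide (e ∈ within ends (extHull ends ζ h u \ {h, u}))

/-- The arm of `x`: its component in `G[H⁺ ∖ {h, u}]`. -/
noncomputable def armC (ζ : Config E) (x : V) : Set V := cluster ends (armConfigC ends h u ζ) x

/-- The edges from `h` or from `u` into `H⁺ ∖ {h, u}`. -/
noncomputable def junctionEdges (ζ : Config E) : Finset E :=
  Finset.univ.filter fun e => ∃ y, (ends e = s(h, y) ∨ ends e = s(u, y)) ∧ y ≠ h ∧ y ≠ u ∧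
    y ∈ extHull ends ζ h u

/-- The arm reached by a junction edge: the arm of its end other than `h` and `u`. -/
noncomputable def armOfEdgeC (ζ : Config E) (e : E) : Set V :=
  {x | ∃ y ∈ ends e, y ≠ h ∧ y ≠ u ∧ x ∈ armC ends h u ζ y}

/-- The finite set of arms of `H⁺`. -/
noncomputable def armsC (ζ : Config E) : Finset (Set V) :=
  (junctionEdges ends h u ζ).image (armOfEdgeC ends h u ζ)

/-- An arm is pure when no edge joins it to `h`. -/
def pureC (P : Set V) : Prop := ∀ e x, ends e = s(h, x) → x ∉ P

variable (U) in
/-- **The core kind**: `u` in the hull of `h`, the hull of `u` inside `U`. -/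
def CoreKind (ζ : Config E) : Prop := u ∈ hull ends ζ h ∧ hull ends ζ u ⊆ U

end Vocabulary

section Sides

variable {U : Set V} {ξ : Config E} {l h o u : V}

omit [Fintype E] [DecidableEq E] in
/-- Membership in `redExt`. -/
lemma mem_redExt_iff {ζ : Config E} {x : V} :
    x ∈ redExt ends h u ζ ↔ (x ∈ cluster ends ζ h ∨ x ∈ cluster ends ζ u) ∧ x ≠ h ∧ x ≠ u := by
  simp only [redExt, Set.mem_sdiff, Set.mem_union, Set.mem_insert_iff, Set.mem_singleton_iff, not_or]

omit [Fintype E] [DecidableEq E] in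
/-- Membership in `blueExt`. -/
lemma mem_blueExt_iff {ζ : Config E} {x : V} :
    x ∈ blueExt ends ζ h u ↔
      (x ∈ cluster ends (blue ζ) h ∨ x ∈ cluster ends (blue ζ) u) ∧ x ≠ h ∧ x ≠ u := by
  simp only [blueExt, Set.mem_sdiff, Set.mem_union, Set.mem_insert_iff, Set.mem_singleton_iff,
    not_or]

omit [Fintype E] [DecidableEq E] in
/-- `redExt` of the blue colouring is `blueExt`. -/
lemma redExt_blue (ζ : Config E) : redExt ends h u (blue ζ) = blueExt ends ζ h u := by
  ext x; rw [mem_redExt_iff, mem_blueExt_iff]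

omit [Fintype E] [DecidableEq E] in
/-- `blueExt` of the blue colouring is `redExt`. -/
lemma blueExt_blue (ζ : Config E) : blueExt ends (blue ζ) h u = redExt ends h u ζ := by
  ext x; rw [mem_redExt_iff, mem_blueExt_iff, blue_blue]

omit [Fintype E] [DecidableEq E] in
/-- The extended hull is the two sides with `h` and `u`. -/
lemma extHull_eq {ζ : Config E} :
    extHull ends ζ h u = {h} ∪ {u} ∪ redExt ends h u ζ ∪ blueExt ends ζ h u := by
  ext x
  simp only [extHull, hull, Set.mem_union, Set.mem_singleton_iff]
  rw [mem_redExt_iff, mem_blueExt_iff]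
  constructor
  · rintro ((hx | hx) | (hx | hx))
    · by_cases hxh : x = h
      · exact Or.inl (Or.inl (Or.inl hxh))
      by_cases hxu : x = u
      · exact Or.inl (Or.inl (Or.inr hxu))
      exact Or.inl (Or.inr ⟨Or.inl hx, hxh, hxu⟩)
    · by_cases hxh : x = h
      · exact Or.inl (Or.inl (Or.inl hxh))
      by_cases hxu : x = u
      · exact Or.inl (Or.inl (Or.inr hxu))
      exact Or.inr ⟨Or.inl hx, hxh, hxu⟩
    · by_cases hxh : x = h
      · exact Or.inl (Or.inl (Or.inl hxh))
      by_cases hxu : x = u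
      · exact Or.inl (Or.inl (Or.inr hxu))
      exact Or.inl (Or.inr ⟨Or.inr hx, hxh, hxu⟩)
    · by_cases hxh : x = h
      · exact Or.inl (Or.inl (Or.inl hxh))
      by_cases hxu : x = u
      · exact Or.inl (Or.inl (Or.inr hxu))
      exact Or.inr ⟨Or.inr hx, hxh, hxu⟩
  · rintro (((rfl | rfl) | ⟨hx | hx, _, _⟩) | ⟨hx | hx, _, _⟩)
    · exact Or.inl (Or.inl (mem_cluster_self _ _ _))
    · exact Or.inr (Or.inl (mem_cluster_self _ _ _))
    · exact Or.inl (Or.inl hx)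
    · exact Or.inr (Or.inl hx)
    · exact Or.inl (Or.inr hx)
    · exact Or.inr (Or.inr hx)

omit [Fintype E] [DecidableEq E] in
/-- In the core kind, `u` is in neither cluster of `l`. -/
lemma u_notMem_cluster_l_of_coreKind (hl : l ∉ U) {ζ : Config E} (hk : CoreKind ends U h u ζ) :
    u ∉ cluster ends ζ l ∧ u ∉ cluster ends (blue ζ) l := by
  constructor
  · intro hu
    exact hl (hk.2 (Or.inl (conn_symm hu)))
  · intro hu
    exact hl (hk.2 (Or.inr (conn_symm hu)))

omit [Fintype E] [DecidableEq E] in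
/-- A vertex of `U ∖ {h, o, u}` that lies in a cluster of `h` or of `u` carries an outside edge. -/
lemma exists_outEdge_of_mem
    (hout : ∀ x ∈ U, x ≠ h → x ≠ o → x ≠ u →
      (∃ e y, ends e = s(x, y) ∧ y ∉ U) ∨ (∀ e, x ∉ ends e))
    {ζ : Config E} {x : V} (hxU : x ∈ U) (hxh : x ≠ h) (hxo : x ≠ o) (hxu : x ≠ u)
    (hx : x ∈ cluster ends ζ h ∨ x ∈ cluster ends ζ u) : ∃ e y, ends e = s(x, y) ∧ y ∉ U := by
  rcases hout x hxU hxh hxo hxu with h' | hiso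
  · exact h'
  · exfalso
    rcases hx with hx | hx
    · obtain ⟨e, hxe⟩ := exists_edge_of_mem_cluster (h := h) hx hxh
      exact hiso e hxe
    · obtain ⟨e, hxe⟩ := exists_edge_of_mem_cluster (h := u) hx hxu
      exact hiso e hxe

/-- **The two sides are disjoint** (the core kind, a `Q`-configuration of the class). -/
theorem redExt_disjoint_blueExt (hl : l ∉ U)
    (hout : ∀ x ∈ U, x ≠ h → x ≠ o → x ≠ u →
      (∃ e y, ends e = s(x, y) ∧ y ∉ U) ∨ (∀ e, x ∉ ends e))
    {ζ : Config E} (hζ : ζ ∈ swOutSide ends l h o U ξ) (hk : CoreKind ends U h u ζ) (x : V)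
    (hxR : x ∈ redExt ends h u ζ) (hxB : x ∈ blueExt ends ζ h u) : False := by
  rw [mem_redExt_iff] at hxR
  rw [mem_blueExt_iff] at hxB
  obtain ⟨hxR, hxh, hxu⟩ := hxR
  obtain ⟨hxB, _, _⟩ := hxB
  have hQ := (mem_swOutSide.1 hζ).1
  have hcl := (mem_swOutSide.1 hζ).2
  rw [mem_tgtU_iff'] at hQ
  obtain ⟨hhl, hoA, _⟩ := hQ
  have hhA : h ∉ cluster ends ζ l := fun h' => hhl (Or.inl h')
  -- `x ∈ U`
  have hxU : x ∈ U := by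
    rcases hxR with hx | hx
    · exact (mem_outClass.1 hcl).2 (Or.inl hx)
    · exact hk.2 (Or.inl hx)
  by_cases hxo : x = o
  · -- the mark: `o ∈ C_R(l)` meets `C_R(h)` or `C_R(u)`
    subst hxo
    rcases hxR with hx | hx
    · exact hhA (conn_trans hoA (conn_symm hx))
    · exact (u_notMem_cluster_l_of_coreKind hl hk).1 (conn_trans hoA (conn_symm hx))
  · obtain ⟨e, y, hxy, hyU⟩ := exists_outEdge_of_mem hout hxU hxh hxo hxu hxR
    cases he : ζ e with
    | true =>
      rcases hxR with hx | hx
      · exact hyU ((mem_outClass.1 hcl).2 (Or.inl (mem_cluster_of_edge hx he hxy)))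
      · exact hyU (hk.2 (Or.inl (mem_cluster_of_edge hx he hxy)))
    | false =>
      have he' : blue ζ e = true := by rw [blue_eq_true_iff]; exact he
      rcases hxB with hx | hx
      · exact hyU ((mem_outClass.1 hcl).2 (Or.inr (mem_cluster_of_edge hx he' hxy)))
      · exact hyU (hk.2 (Or.inr (mem_cluster_of_edge hx he' hxy)))

omit [Fintype E] [DecidableEq E] in
/-- **No edge joins the two sides** (given that they are disjoint). -/
theorem no_edge_redExt_blueExt {ζ : Config E}
    (hdisj : ∀ x, x ∈ redExt ends h u ζ → x ∈ blueExt ends ζ h u → False) {e : E} {x y : V}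
    (hxy : ends e = s(x, y)) (hx : x ∈ redExt ends h u ζ) (hy : y ∈ blueExt ends ζ h u) : False := by
  rw [mem_redExt_iff] at hx
  rw [mem_blueExt_iff] at hy
  cases he : ζ e with
  | true =>
    -- `y` joins the red side
    refine hdisj y ?_ (mem_blueExt_iff.2 hy)
    rw [mem_redExt_iff]
    refine ⟨?_, hy.2.1, hy.2.2⟩
    rcases hx.1 with hx' | hx'
    · exact Or.inl (mem_cluster_of_edge hx' he hxy)
    · exact Or.inr (mem_cluster_of_edge hx' he hxy)
  | false =>
    have he' : blue ζ e = true := by rw [blue_eq_true_iff]; exact he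
    refine hdisj x (mem_redExt_iff.2 hx) ?_
    rw [mem_blueExt_iff]
    refine ⟨?_, hx.2.1, hx.2.2⟩
    rcases hy.1 with hy' | hy'
    · exact Or.inl (mem_cluster_of_edge hy' he' (ends_swap hxy))
    · exact Or.inr (mem_cluster_of_edge hy' he' (ends_swap hxy))

end Sides

end LocRows

end Summit.Ventures.PercRepro2
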